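import Summits.CriticalPhenomena.SAWScalingLimit.Theorems.SAWDevelopingMapObservableToSLERestrictionCocycleHelpersFloor
import Summits.CriticalPhenomena.SAWScalingLimit.Theorems.SAWDefectDecoherenceBoundaryClosureRPickEngineWeakDbarSum
import Summits.CriticalPhenomena.SAWScalingLimit.Theorems.SAWDefectDecoherenceBoundaryClosureRGateTraceGateBall
import HarnessLib

/-!
# Gate `∂̄`-limit, IV: the Taylor remainder and the boundary part of `N_δ` at one mesh
(crux `BoundaryClosureR`, stmt-CriticalPhenomena-14004, line `polygon-parity-squeeze`, registered
stub `stub_gateDbarLimit`, mechanism (C))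

Three pieces of bookkeeping for the assembly of `GateDbarLimit` (`…GateDbarLimit.lean`):

* `finsum_midEdges_split` — the normalised functional `N_δ(ψ)` sums over ALL mid-edges of `Ω_δ`;
  split it into the up-oriented interior edge sum (the left side of the Taylor-expanded Green
  identity `HexObservableLimitR.greenLimit_identity`) plus the sum over the boundary mid-edges;
* `norm_boundary_finsum_le` — the boundary part, for a bounded test function supported in the
  quarter gate ball, is dominated by the bump-tested gate arrival sum `Σ_{gate} β(δ mid e) Z(e)`
  (`‖F_{5/8}‖ ≤ Z`), which the gate profile law bounds by `O(Z(b)/δ)`;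
* `remainder_indicator_le` — the mass in the Taylor remainder of the Green identity
  (`HexObservableLimitR.greenLimit_remainder_norm_le`: edges with scaled midpoint near `supp φ`) is
  dominated by the star masses of the vertices with scaled centre in the quarter gate ball, i.e. by
  the layer cake of `GateDbar.layerCake_le` with unit weights (`O(δ^{-11/4}) Z(b)`; times `δ³`:
  `O(δ^{1/4})`);
* `norm_bumpSum_eq` — the bump-tested profile sum is a nonnegative real: its norm.

Reference: Duminil-Copin–Smirnov, Ann. of Math. 175 (2012), §3.
-/

noncomputable section

open scoped BigOperators Topology Classical
open Filter Set Metric Complex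
open Literature.Probability.LatticeModels Literature.Probability.RandomPlanarGeometry
open Literature.Probability.RandomPlanarGeometry.SAW
open Literature.Barriers.CriticalPhenomena.HexGreen (nbrs mem_nbrs_iff)
open Summit.CriticalPhenomena.SAWScalingLimit.Theorems.PickHalfPlane
open Summit.CriticalPhenomena.SAWScalingLimit.Theorems.DecoherenceSynthesis (norm_hexMidpoint_sub_hexCenter_le)
open Summit.CriticalPhenomena.SAWScalingLimit.Theorems.ObservableToSLE.FloorRatio (dist_smul_mesh)
open Summit.CriticalPhenomena.SAWScalingLimit.Theorems.MassRatio.Negative (hexDomainMidEdges_finite)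

namespace Summit.CriticalPhenomena.SAWScalingLimit.Theorems.PolygonParitySqueeze.GateDbar

/-! ### 1. Splitting the functional into interior edges and boundary mid-edges -/

/-- An edge with both endpoints in `Λ` is not a boundary mid-edge. [cite: DuminilCopinSmirnov2012, §2 (domains)] -/
theorem not_mem_boundary_of_mem {Λ : Finset HexVertex} {v w : HexVertex} (hv : v ∈ Λ) (hw : w ∈ Λ) :
    s(v, w) ∉ hexDomainBoundary Λ := by
  rintro ⟨-, u, u', he, hu', hu⟩
  rcases Sym2.eq_iff.1 he with ⟨rfl, rfl⟩ | ⟨rfl, rfl⟩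
  · exact hu hv
  · exact hu hw

/-- **Interior/boundary split of a sum over the mid-edges of `Ω`.** For every `g`,
`Σᶠ_{z ∈ Ω(Λ)} g z = Σ_{v up ∈ Λ} Σ_{t ∈ Λ, t ∼ v} g{v,t} + Σᶠ_{e ∈ ∂Ω(Λ)} g e` (every interior edge has
exactly one up endpoint). [cite: DuminilCopinSmirnov2012, §2 (domains)] -/
theorem finsum_midEdges_split (Λ : Finset HexVertex) (g : Sym2 HexVertex → ℂ) :
    ∑ᶠ z ∈ hexDomainMidEdges Λ, g z =
      ∑ v ∈ Λ.filter (fun v => v.2 = 0), ∑ t ∈ Λ.filter (fun t => hexGraph.Adj v t), g s(v, t) +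
        ∑ᶠ e ∈ hexDomainBoundary Λ, g e := by
  classical
  set g₁ : Sym2 HexVertex → ℂ := fun z => if z ∈ hexDomainBoundary Λ then 0 else g z with hg₁
  set g₂ : Sym2 HexVertex → ℂ := fun z => if z ∈ hexDomainBoundary Λ then g z else 0 with hg₂
  have hsum : ∀ z, g z = g₁ z + g₂ z := fun z => by
    simp only [hg₁, hg₂]; split_ifs <;> simp
  have hfin : (hexDomainMidEdges Λ).Finite := hexDomainMidEdges_finite Λ
  rw [finsum_mem_congr rfl (fun z _ => hsum z), finsum_mem_add_distrib hfin]
  congr 1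
  · -- the interior part
    rw [Engine.finsum_midEdges_eq_sum_up Λ g₁ (fun v w hadj hv hw => by
      simp only [hg₁, if_pos (show s(v, w) ∈ hexDomainBoundary Λ from
        ⟨(SimpleGraph.mem_edgeSet hexGraph).2 hadj, w, v, Sym2.eq_swap, hv, hw⟩)])]
    refine Finset.sum_congr rfl fun v hv => ?_
    have hin : (nbrs v).filter (· ∈ Λ) = Λ.filter (fun t => hexGraph.Adj v t) := by
      ext t
      simp only [Finset.mem_filter, mem_nbrs_iff]
      tauto
    rw [hin]
    refine Finset.sum_congr rfl fun t ht => ?_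
    simp only [hg₁, if_neg (not_mem_boundary_of_mem (Finset.mem_filter.1 hv).1 (Finset.mem_filter.1 ht).1)]
  · -- the boundary part
    rw [finsum_mem_inter_support_eq g₂ (hexDomainMidEdges Λ) (hexDomainBoundary Λ)]
    · exact finsum_mem_congr rfl fun z hz => by simp only [hg₂, if_pos hz]
    · ext z
      simp only [Set.mem_inter_iff, Function.mem_support, hg₂]
      constructor
      · rintro ⟨-, hz⟩
        by_cases h : z ∈ hexDomainBoundary Λ
        · exact ⟨h, by simpa [h] using hz⟩
        · simp [h] at hz
      · rintro ⟨hz, hne⟩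
        exact ⟨hexDomainBoundary_subset Λ hz, hne⟩

/-! ### 2. The boundary part of the functional -/

/-- **The boundary part is dominated by the bump-tested gate arrivals.** If `‖ψ‖ ≤ Mψ`, `ψ ≠ 0`
only where `β ≥ 1`, `β ≥ 0`, and `β(δ·mid e) ≠ 0` only for scaled midpoints in `B(c, r)`, then
`‖Σᶠ_{∂Ω} ψ(δ mid e) F_{5/8}(e)‖ ≤ Mψ Σᶠ_{e ∈ ∂Ω, δ mid e ∈ B(c,r)} β(δ mid e) Z(e)`.
[cite: DuminilCopinSmirnov2012, Def. 1] -/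
theorem norm_boundary_finsum_le (Λ : Finset HexVertex) (a : Sym2 HexVertex) (δ : ℝ) {ψ : ℂ → ℂ}
    {β : ℂ → ℝ} {Mψ r : ℝ} {c : ℂ} (hMψ : ∀ z, ‖ψ z‖ ≤ Mψ) (hψβ : ∀ z, ψ z ≠ 0 → 1 ≤ β z)
    (hβ0 : ∀ z, 0 ≤ β z) (hβs : ∀ z, β z ≠ 0 → z ∈ ball c r) :
    ‖∑ᶠ e ∈ hexDomainBoundary Λ, ψ ((δ : ℂ) * hexMidpoint e) *
        hexParafermionicObservable Λ a hexCriticalFugacity (5 / 8) e‖ ≤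
      Mψ * ∑ᶠ e ∈ {e : Sym2 HexVertex | e ∈ hexDomainBoundary Λ ∧ (δ : ℂ) * hexMidpoint e ∈ ball c r},
        β ((δ : ℂ) * hexMidpoint e) * ‖hexParafermionicObservable Λ a hexCriticalFugacity 0 e‖ := by
  classical
  set F := hexParafermionicObservable Λ a hexCriticalFugacity (5 / 8) with hF
  set Z := hexParafermionicObservable Λ a hexCriticalFugacity 0 with hZ
  have hMψ0 : 0 ≤ Mψ := (norm_nonneg _).trans (hMψ 0)
  have hfin := GateMass.finite_hexDomainBoundary Λ
  -- the window sum is the full boundary sum (the bump vanishes elsewhere)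
  have hW : ∑ᶠ e ∈ {e : Sym2 HexVertex | e ∈ hexDomainBoundary Λ ∧ (δ : ℂ) * hexMidpoint e ∈ ball c r},
      β ((δ : ℂ) * hexMidpoint e) * ‖Z e‖ = ∑ᶠ e ∈ hexDomainBoundary Λ, β ((δ : ℂ) * hexMidpoint e) * ‖Z e‖ := by
    refine finsum_mem_inter_support_eq _ _ _ ?_
    ext e
    simp only [Set.mem_inter_iff, Set.mem_setOf_eq, Function.mem_support]
    constructor
    · rintro ⟨⟨he, -⟩, hne⟩; exact ⟨he, hne⟩
    · rintro ⟨he, hne⟩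
      exact ⟨⟨he, hβs _ (fun h => hne (by rw [h, zero_mul]))⟩, hne⟩
  rw [hW, finsum_mem_eq_finite_toFinset_sum _ hfin, finsum_mem_eq_finite_toFinset_sum _ hfin, Finset.mul_sum]
  refine (norm_sum_le _ _).trans (Finset.sum_le_sum fun e _ => ?_)
  rw [norm_mul]
  by_cases h0 : ψ ((δ : ℂ) * hexMidpoint e) = 0
  · rw [h0, norm_zero, zero_mul]
    have := hβ0 ((δ : ℂ) * hexMidpoint e)
    positivity
  · have h1 := hψβ _ h0
    calc ‖ψ ((δ : ℂ) * hexMidpoint e)‖ * ‖F e‖ ≤ Mψ * 1 * ‖Z e‖ := by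
          rw [mul_one]
          exact mul_le_mul (hMψ _) (GateMass.norm_obs_le_norm_obs_zero Λ a (5 / 8) e) (norm_nonneg _) hMψ0
      _ ≤ Mψ * β ((δ : ℂ) * hexMidpoint e) * ‖Z e‖ := by gcongr
      _ = Mψ * (β ((δ : ℂ) * hexMidpoint e) * ‖Z e‖) := by ring

/-! ### 3. The mass in the Taylor remainder -/

/-- **Remainder mass versus star masses.** If `supp φ ⊆ B(c, ρφ)` (`0 ≤ ρφ`, `0 ≤ r`,
`δ/2 + r + ρφ < ρ/4`), the `b`-normalised mass of the up-oriented interior edges whose scaled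
midpoint lies in the `r`-thickening of `supp φ` is at most `δ²/‖F(b)‖` times the total star mass of
the vertices of `Λ` with scaled centre in `B(c, ρ/4)` (each such edge lies in the star of its up
endpoint, whose scaled centre is within `δ/2` of the midpoint; `‖F_{5/8}‖ ≤ Z`).
[cite: DuminilCopinSmirnov2012, Def. 1] -/
theorem remainder_indicator_le (Λ : Finset HexVertex) (a b : Sym2 HexVertex) (m : ℤ) {δ ρ ρφ r : ℝ}
    {c : ℂ} {φ : ℂ → ℂ} (hδ : 0 ≤ δ) (hρφ : 0 ≤ ρφ) (hr : 0 ≤ r) (hφs : tsupport φ ⊆ ball c ρφ)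
    (hgap : δ / 2 + r + ρφ < ρ / 4) :
    ∑ v ∈ Λ.filter (fun v => v.2 = 0), ∑ t ∈ Λ.filter (fun t => hexGraph.Adj v t),
        (cthickening r (tsupport φ)).indicator
          (fun _ => ‖(δ : ℂ) ^ 2 * hexParafermionicObservable Λ a hexCriticalFugacity (5 / 8) s(v, t) /
            hexParafermionicObservable Λ a hexCriticalFugacity (5 / 8) b‖) ((δ : ℂ) * hexMidpoint s(v, t)) ≤
      δ ^ 2 / ‖hexParafermionicObservable Λ a hexCriticalFugacity (5 / 8) b‖ *
        ∑ v ∈ Λ.filter (fun v => (δ : ℂ) * hexCenter v ∈ ball c (ρ / 4)),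
          (fun _ : ℕ => (1 : ℝ)) (v.1 1 - m).toNat * starMass Λ a v := by
  classical
  set F := hexParafermionicObservable Λ a hexCriticalFugacity (5 / 8) with hF
  set Z := hexParafermionicObservable Λ a hexCriticalFugacity 0 with hZ
  -- the thickened support sits in a closed ball of radius `r + ρφ`
  have hthick : cthickening r (tsupport φ) ⊆ closedBall c (r + ρφ) := by
    calc cthickening r (tsupport φ) ⊆ cthickening r (closedBall c ρφ) :=
          cthickening_subset_of_subset r (hφs.trans ball_subset_closedBall)
      _ = closedBall c (r + ρφ) := cthickening_closedBall hr hρφ c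
  -- per vertex weight
  set W : HexVertex → ℝ := fun v => if (δ : ℂ) * hexCenter v ∈ ball c (ρ / 4) then 1 else 0 with hW
  have hvertex : ∀ v ∈ Λ.filter (fun v => v.2 = 0), ∑ t ∈ Λ.filter (fun t => hexGraph.Adj v t),
      (cthickening r (tsupport φ)).indicator (fun _ => ‖(δ : ℂ) ^ 2 * F s(v, t) / F b‖)
        ((δ : ℂ) * hexMidpoint s(v, t)) ≤ δ ^ 2 / ‖F b‖ * (W v * starMass Λ a v) := by
    intro v _
    by_cases hvb : (δ : ℂ) * hexCenter v ∈ ball c (ρ / 4)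
    · have hWv : W v = 1 := by simp only [hW, if_pos hvb]
      rw [hWv, one_mul, starMass, Finset.mul_sum]
      refine Finset.sum_le_sum fun t _ => ?_
      have hle : ‖(δ : ℂ) ^ 2 * F s(v, t) / F b‖ ≤ δ ^ 2 / ‖F b‖ * ‖Z s(v, t)‖ := by
        rw [norm_div, norm_mul, norm_pow, Complex.norm_real, Real.norm_of_nonneg hδ, div_eq_mul_inv,
          div_eq_mul_inv]
        have := GateMass.norm_obs_le_norm_obs_zero Λ a (5 / 8) s(v, t)
        have h0 : 0 ≤ (‖F b‖)⁻¹ := inv_nonneg.2 (norm_nonneg _)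
        nlinarith [norm_nonneg (F s(v, t)), sq_nonneg δ, mul_nonneg (sq_nonneg δ) h0]
      by_cases hm : (δ : ℂ) * hexMidpoint s(v, t) ∈ cthickening r (tsupport φ)
      · rw [indicator_of_mem hm]; exact hle
      · rw [indicator_of_notMem hm]
        exact mul_nonneg (div_nonneg (sq_nonneg _) (norm_nonneg _)) (norm_nonneg _)
    · -- off the quarter ball no midpoint of the star is near the support
      have hWv : W v = 0 := by simp only [hW, if_neg hvb]
      rw [hWv, zero_mul, mul_zero]
      refine (Finset.sum_eq_zero fun t ht => ?_).le
      have hadj : hexGraph.Adj v t := (Finset.mem_filter.1 ht).2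
      refine indicator_of_notMem (fun hm => hvb ?_) _
      have h1 := mem_closedBall.1 (hthick hm)
      have h2 : dist ((δ : ℂ) * hexCenter v) ((δ : ℂ) * hexMidpoint s(v, t)) ≤ δ / 2 := by
        rw [dist_comm, dist_smul_mesh hδ, dist_eq_norm]
        exact (mul_le_mul_of_nonneg_left (norm_hexMidpoint_sub_hexCenter_le hadj) hδ).trans (by linarith)
      rw [mem_ball]
      linarith [dist_triangle ((δ : ℂ) * hexCenter v) ((δ : ℂ) * hexMidpoint s(v, t)) c]
  calc ∑ v ∈ Λ.filter (fun v => v.2 = 0), ∑ t ∈ Λ.filter (fun t => hexGraph.Adj v t),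
        (cthickening r (tsupport φ)).indicator (fun _ => ‖(δ : ℂ) ^ 2 * F s(v, t) / F b‖)
          ((δ : ℂ) * hexMidpoint s(v, t))
      ≤ ∑ v ∈ Λ.filter (fun v => v.2 = 0), δ ^ 2 / ‖F b‖ * (W v * starMass Λ a v) :=
        Finset.sum_le_sum hvertex
    _ ≤ ∑ v ∈ Λ, δ ^ 2 / ‖F b‖ * (W v * starMass Λ a v) := by
        refine Finset.sum_le_sum_of_subset_of_nonneg (Finset.filter_subset _ _) fun v _ _ => ?_
        refine mul_nonneg (div_nonneg (sq_nonneg _) (norm_nonneg _)) (mul_nonneg ?_ ?_)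
        · simp only [hW]; split_ifs <;> norm_num
        · exact Finset.sum_nonneg fun _ _ => norm_nonneg _
    _ = δ ^ 2 / ‖F b‖ * ∑ v ∈ Λ.filter (fun v => (δ : ℂ) * hexCenter v ∈ ball c (ρ / 4)),
          (fun _ : ℕ => (1 : ℝ)) (v.1 1 - m).toNat * starMass Λ a v := by
        rw [← Finset.mul_sum, Finset.sum_filter]
        congr 1
        refine Finset.sum_congr rfl fun v _ => ?_
        simp only [hW]
        split_ifs <;> simp

/-! ### 4. The bump-tested profile sum is a nonnegative real -/

/-- **Norm of the bump-tested profile sum**: for a real weight `β ≥ 0` and `δ ≥ 0`,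
`‖δ Σᶠ_{W} β(δ mid e) · Z(e)/Z(b)‖ = δ (Σᶠ_{W} β(δ mid e) Z(e)) / Z(b)` (all terms are nonnegative reals).
[cite: DuminilCopinSmirnov2012, Def. 1 (σ = 0)] -/
theorem norm_bumpSum_eq (Λ : Finset HexVertex) (a b : Sym2 HexVertex) {δ : ℝ} (hδ : 0 ≤ δ)
    {β : ℂ → ℝ} (hβ0 : ∀ z, 0 ≤ β z) (W : Set (Sym2 HexVertex)) (hW : W.Finite) :
    ‖(δ : ℂ) * ∑ᶠ e ∈ W, ((β ((δ : ℂ) * hexMidpoint e) : ℝ) : ℂ) *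
        (hexParafermionicObservable Λ a hexCriticalFugacity 0 e /
          hexParafermionicObservable Λ a hexCriticalFugacity 0 b)‖ =
      δ * (∑ᶠ e ∈ W, β ((δ : ℂ) * hexMidpoint e) * ‖hexParafermionicObservable Λ a hexCriticalFugacity 0 e‖) /
        ‖hexParafermionicObservable Λ a hexCriticalFugacity 0 b‖ := by
  set Z := hexParafermionicObservable Λ a hexCriticalFugacity 0 with hZ
  have hZe : ∀ e, Z e = ((‖Z e‖ : ℝ) : ℂ) := fun e => obs_zero_eq_ofReal_norm _ _ _
  have hcongr : ∑ᶠ e ∈ W, ((β ((δ : ℂ) * hexMidpoint e) : ℝ) : ℂ) * (Z e / Z b) =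
      ∑ᶠ e ∈ W, (((β ((δ : ℂ) * hexMidpoint e) * ‖Z e‖ / ‖Z b‖ : ℝ)) : ℂ) := by
    refine finsum_mem_congr rfl fun e _ => ?_
    conv_lhs => rw [hZe e, hZe b]
    push_cast
    ring
  have hsum : ∑ᶠ e ∈ W, (((β ((δ : ℂ) * hexMidpoint e) * ‖Z e‖ / ‖Z b‖ : ℝ)) : ℂ) =
      (((∑ᶠ e ∈ W, β ((δ : ℂ) * hexMidpoint e) * ‖Z e‖) / ‖Z b‖ : ℝ) : ℂ) := by
    rw [finsum_mem_eq_finite_toFinset_sum _ hW, finsum_mem_eq_finite_toFinset_sum _ hW, Finset.sum_div,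
      Complex.ofReal_sum]
  have hRnn : 0 ≤ ∑ᶠ e ∈ W, β ((δ : ℂ) * hexMidpoint e) * ‖Z e‖ :=
    finsum_nonneg fun e => finsum_nonneg fun _ => mul_nonneg (hβ0 _) (norm_nonneg _)
  rw [hcongr, hsum, ← Complex.ofReal_mul, Complex.norm_real,
    Real.norm_of_nonneg (mul_nonneg hδ (div_nonneg hRnn (norm_nonneg _))), mul_div_assoc]

/-! ### Registered form (sub-goal of `stub_gateDbarLimit`) -/

/-- **Registered sub-goal `gateDbar_midEdgesSplit`** (crux item stmt-CriticalPhenomena-14004, line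
`polygon-parity-squeeze`, stub `stub_gateDbarLimit`, mechanism (C)): registry form (one `∀`-term) of
`finsum_midEdges_split`. [cite: DuminilCopinSmirnov2012, §2 (domains)] -/
theorem gateDbar_midEdgesSplit : ∀ (Λ : Finset HexVertex) (g : Sym2 HexVertex → ℂ), ∑ᶠ z ∈ hexDomainMidEdges Λ, g z = ∑ v ∈ Λ.filter (fun v => v.2 = 0), ∑ t ∈ Λ.filter (fun t => hexGraph.Adj v t), g s(v, t) + ∑ᶠ e ∈ hexDomainBoundary Λ, g e :=
  fun Λ g => finsum_midEdges_split Λ g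

end Summit.CriticalPhenomena.SAWScalingLimit.Theorems.PolygonParitySqueeze.GateDbar

end
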